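import Literature.NumberTheory.Automorphic.FiniteAdeleSchwartzBruhatTensor
import Literature.NumberTheory.Automorphic.RestrictedTensorProductSmoothProofs
import Literature.NumberTheory.Automorphic.SmoothRepresentationLocallyConstant
import Mathlib.Topology.Algebra.RestrictedProduct.TopologicalSpace
import HarnessLib

/-!
# The finite-adelic representation `⊗'_v r_v` on `𝒮((𝔸_{K,f})^ι)` assembled from local data

Generic ASSEMBLY of a finite-adelic representation from local representations, on the CONCRETE
carrier `𝒮((𝔸_{K,f})^ι) = SchwartzBruhat (ι → 𝔸_{K,f})`, using the certificate
`isRestrictedTensorProduct_piProdSB : IsRestrictedTensorProduct ℂ (piProdSB K ι) ∅`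
(`FiniteAdeleSchwartzBruhatTensor`): `𝒮((𝔸_{K,f})^ι) = ⊗'_v 𝒮(K_v^ι)` with respect to the base
vectors `unitVec K ι v = 1_{𝒪_v^ι}` and the pure tensors `piProdSB`.

Input (all DATA / HYPOTHESES, nothing asserted): for every finite place `v` a group `G v`, a
subgroup `Kc v ≤ G v` and a representation `r v` of `G v` on `𝒮(K_v^ι)`, such that `Kc v` fixes
`1_{𝒪_v^ι}` for all but finitely many `v` (`hK`). In the application `G v` is the local
(tautological) metaplectic group of `ψ_v` acting by the Schrödinger–Weil operators and `Kc v` the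
stabiliser of the unramified vector (Weil 1964 n° 37–39; Moeglin–Vignéras–Waldspurger 1987, ch. 2,
II.10), and the SPLITTING over the unitary dual pair enters through `finiteAdelePullback` as the datum of local
homomorphisms `s v : H v →* G v` (Kudla 1994, Thm 3.1; Harris–Kudla–Sweet 1996, §1) — supplied by
the caller, never asserted here.

Output (kernel):
* `finiteAdeleRep K ι r hK : Representation ℂ (Πʳ v, [G v, Kc v]) 𝒮((𝔸_{K,f})^ι)` = `⊗'_v r v`,
  acting on pure tensors factor by factor (`finiteAdeleRep_apply_piProdSB`,
  `coe_finiteAdeleRep_apply_piProdSB`), with the tree certificate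
  `isRestrictedTensorProductRep_finiteAdeleRep` and uniqueness `eq_finiteAdeleRep` (any
  representation for which `piProdSB` is equivariant IS this one);
* SMOOTHNESS `isSmooth_finiteAdeleRep`: if the `G v` are topological groups, the `Kc v` are open and
  every `r v` is smooth then `⊗'_v r v` is smooth for Mathlib's restricted product topology (the
  tree's `IsRestrictedTensorProductRep.isSmooth_holds`, Flath 1979 §2 Example 2), whence every orbit
  map `g ↦ (⊗' r)(g) Φ` is locally constant (`isLocallyConstant_finiteAdeleRep_apply`, through the
  tree's `Representation.IsSmooth.isLocallyConstant_apply`) — the input `hf`/`hsmooth` of the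
  theta-majorant junction;
* `finiteAdelePullback`: restriction along a restricted product of local homomorphisms
  `s v : H v →* G v` mapping `KH v` into `Kc v` almost everywhere (Mathlib's
  `RestrictedProduct.mapAlongMonoidHom`), its action on pure tensors and its smoothness.

## References

* [Flath1979] D. Flath, Decomposition of representations into tensor products, Corvallis 1979,
  §2, Example 2.
* [Weil1964] A. Weil, Sur certains groupes d'opérateurs unitaires, Acta Math. 111 (1964), n° 37–39.
* [MoeglinVignerasWaldspurger1987] C. Moeglin, M.-F. Vignéras, J.-L. Waldspurger, Correspondances
  de Howe sur un corps p-adique, LNM 1291, ch. 2, II.10.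
* [Kudla1994] S. Kudla, Splitting metaplectic covers of dual reductive pairs, Israel J. Math. 87
  (1994), Thm 3.1.
* [HarrisKudlaSweet1996] M. Harris, S. Kudla, W. J. Sweet, Theta dichotomy for unitary groups,
  J. Amer. Math. Soc. 9 (1996), §1.
-/

noncomputable section

open scoped RestrictedProduct

open Filter Function Set IsDedekindDomain NumberField

namespace Literature.NumberTheory.Automorphic

universe uG uH

variable (K : Type) [Field K] [NumberField K] (ι : Type) [Fintype ι]
  [DecidableEq (HeightOneSpectrum (𝓞 K))]

section Rep

variable {G : HeightOneSpectrum (𝓞 K) → Type uG} [∀ v, Group (G v)] {Kc : ∀ v, Subgroup (G v)}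
  (r : ∀ v, Representation ℂ (G v) ↥(SchwartzBruhat (ι → v.adicCompletion K)))
  (hK : ∀ᶠ v in cofinite, unitVec K ι v ∈ (r v).fixedPoints (Kc v))

/-- **The finite-adelic representation `⊗'_v r_v`** of the restricted product `Πʳ v, [G v, Kc v]`
on `𝒮((𝔸_{K,f})^ι)`, with respect to the base vectors `1_{𝒪_v^ι}` (fixed by `Kc v` for almost all
`v`, hypothesis `hK`): the tree's `IsRestrictedTensorProduct.rep` on the concrete model
`(𝒮((𝔸_{K,f})^ι), piProdSB)`. (Flath 1979, §2, Example 2; Weil 1964, n° 37–39.)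
[cite: Flath1979, §2  Example 2] -/
def finiteAdeleRep :
    Representation ℂ (Πʳ v, [G v, Kc v]) ↥(SchwartzBruhat (ι → FiniteAdeleRing (𝓞 K) K)) :=
  (isRestrictedTensorProduct_piProdSB K ι).rep r hK

/-- **Action on pure tensors**: `(⊗' r)(g) (⊗_v Φ_v) = ⊗_v r_v(g_v) Φ_v`. [folklore] -/
@[simp] theorem finiteAdeleRep_apply_piProdSB (g : Πʳ v, [G v, Kc v]) (Φ : LocalSBFamily K ι) :
    finiteAdeleRep K ι r hK g (piProdSB K ι Φ) = piProdSB K ι (RestrictedFamily.smul r hK g Φ) :=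
  (isRestrictedTensorProduct_piProdSB K ι).rep_apply r hK g Φ

/-- Action on pure tensors, as functions on `(𝔸_{K,f})^ι`:
`((⊗' r)(g) (⊗_v Φ_v))(x) = ∏ᶠ_v (r_v(g_v) Φ_v)(x_v)`. [folklore] -/
theorem coe_finiteAdeleRep_apply_piProdSB (g : Πʳ v, [G v, Kc v]) (Φ : LocalSBFamily K ι)
    (x : ι → FiniteAdeleRing (𝓞 K) K) :
    ((finiteAdeleRep K ι r hK g (piProdSB K ι Φ) : ↥(SchwartzBruhat _)) :
        (ι → FiniteAdeleRing (𝓞 K) K) → ℂ) x =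
      ∏ᶠ v, ((r v (g v) (Φ v) : ↥(SchwartzBruhat _)) : (ι → v.adicCompletion K) → ℂ)
        fun i => x i v := by
  rw [finiteAdeleRep_apply_piProdSB, coe_piProdSB]
  rfl

/-- `(𝒮((𝔸_{K,f})^ι), ⊗' r, piProdSB)` **is a restricted tensor product of the representations
`r v`** (tree predicate, exceptional set `∅`). [folklore] -/
theorem isRestrictedTensorProductRep_finiteAdeleRep :
    IsRestrictedTensorProductRep r (finiteAdeleRep K ι r hK) hK (piProdSB K ι) ∅ :=
  (isRestrictedTensorProduct_piProdSB K ι).isRestrictedTensorProductRep_rep r hK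

/-- **Uniqueness**: a representation of `Πʳ v, [G v, Kc v]` on `𝒮((𝔸_{K,f})^ι)` acting on pure
tensors factor by factor IS `⊗' r` (pure tensors span, `span_range_piProdSB`). [folklore] -/
theorem eq_finiteAdeleRep
    {π : Representation ℂ (Πʳ v, [G v, Kc v]) ↥(SchwartzBruhat (ι → FiniteAdeleRing (𝓞 K) K))}
    (hπ : ∀ (g : Πʳ v, [G v, Kc v]) (Φ : LocalSBFamily K ι),
      π g (piProdSB K ι Φ) = piProdSB K ι (RestrictedFamily.smul r hK g Φ)) :
    π = finiteAdeleRep K ι r hK :=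
  MonoidHom.ext fun g => (isRestrictedTensorProduct_piProdSB K ι).linearMap_ext fun Φ => by
    rw [hπ, finiteAdeleRep_apply_piProdSB]

/-- Uniqueness, predicate form: any `π` making `(𝒮((𝔸_{K,f})^ι), π, piProdSB)` a restricted tensor
product of the `r v` (any exceptional set) equals `⊗' r`. [folklore] -/
theorem IsRestrictedTensorProductRep.eq_finiteAdeleRep {S₀ : Finset (HeightOneSpectrum (𝓞 K))}
    {π : Representation ℂ (Πʳ v, [G v, Kc v]) ↥(SchwartzBruhat (ι → FiniteAdeleRing (𝓞 K) K))}
    (hπ : IsRestrictedTensorProductRep r π hK (piProdSB K ι) S₀) :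
    π = finiteAdeleRep K ι r hK :=
  Literature.NumberTheory.Automorphic.eq_finiteAdeleRep K ι r hK fun g Φ => (hπ.2 g Φ).symm

/-! ### Smoothness -/

variable [∀ v, TopologicalSpace (G v)] [∀ v, IsTopologicalGroup (G v)]

/-- **`⊗'_v r_v` is smooth** (every vector has open stabiliser in the restricted product topology)
when the `Kc v` are open and the `r v` are smooth. (Flath 1979, §2, Example 2 — the tree's
`IsRestrictedTensorProductRep.isSmooth_holds`.) [cite: Flath1979, §2  Example 2] -/
theorem isSmooth_finiteAdeleRep (hKo : ∀ v, IsOpen (Kc v : Set (G v)))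
    (hr : ∀ v, (r v).IsSmooth) : (finiteAdeleRep K ι r hK).IsSmooth :=
  IsRestrictedTensorProductRep.isSmooth_holds hKo hr
    (isRestrictedTensorProductRep_finiteAdeleRep K ι r hK)

end Rep

/-! ### Smoothness is inherited by pull-back -/

section Comp

variable {Γ : Type*} [Group Γ] [TopologicalSpace Γ]
  {V : Type*} [AddCommGroup V] [Module ℂ V] (π : Representation ℂ Γ V)

/-- Smoothness is inherited by pull-back along a continuous homomorphism (the stabiliser of `v`
for `π ∘ f` is the preimage of its stabiliser for `π`). [folklore] -/
theorem isSmooth_comp_of_continuous {Γ' : Type*} [Group Γ'] [TopologicalSpace Γ']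
    (hπ : π.IsSmooth) (f : Γ' →* Γ) (hf : Continuous f) :
    Representation.IsSmooth (k := ℂ) (G := Γ') (V := V) (π.comp f) := by
  intro v
  have h : (Representation.stabilizerSubgroup (k := ℂ) (G := Γ') (V := V) (π.comp f) v : Set Γ') =
      f ⁻¹' (π.stabilizerSubgroup v : Set Γ) := by
    ext g
    simp [Representation.mem_stabilizerSubgroup]
  show IsOpen (Representation.stabilizerSubgroup (k := ℂ) (G := Γ') (V := V) (π.comp f) v : Set Γ')
  rw [h]
  exact (hπ v).preimage hf

end Comp

section RepTop

variable {G : HeightOneSpectrum (𝓞 K) → Type uG} [∀ v, Group (G v)] {Kc : ∀ v, Subgroup (G v)}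
  (r : ∀ v, Representation ℂ (G v) ↥(SchwartzBruhat (ι → v.adicCompletion K)))
  (hK : ∀ᶠ v in cofinite, unitVec K ι v ∈ (r v).fixedPoints (Kc v))
  [∀ v, TopologicalSpace (G v)] [∀ v, IsTopologicalGroup (G v)]

/-- **Orbit maps of `⊗'_v r_v` are locally constant** (`Kc v` open, `r v` smooth): for every
`Φ ∈ 𝒮((𝔸_{K,f})^ι)`, `g ↦ (⊗' r)(g) Φ` is locally constant on `Πʳ v, [G v, Kc v]` — the
finite-adelic smoothness input of the theta-series majorants. [folklore] -/
theorem isLocallyConstant_finiteAdeleRep_apply [Fact (∀ v, IsOpen (Kc v : Set (G v)))]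
    (hr : ∀ v, (r v).IsSmooth) (Φ : ↥(SchwartzBruhat (ι → FiniteAdeleRing (𝓞 K) K))) :
    IsLocallyConstant fun g : Πʳ v, [G v, Kc v] => finiteAdeleRep K ι r hK g Φ :=
  (isSmooth_finiteAdeleRep K ι r hK (Fact.out : ∀ v, IsOpen (Kc v : Set (G v)))
    hr).isLocallyConstant_apply _ Φ

end RepTop

/-! ### Pull-back along local homomorphisms (the splitting datum) -/

section Pullback

variable {G : HeightOneSpectrum (𝓞 K) → Type uG} [∀ v, Group (G v)] {Kc : ∀ v, Subgroup (G v)}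
  (r : ∀ v, Representation ℂ (G v) ↥(SchwartzBruhat (ι → v.adicCompletion K)))
  (hK : ∀ᶠ v in cofinite, unitVec K ι v ∈ (r v).fixedPoints (Kc v))
  {H : HeightOneSpectrum (𝓞 K) → Type uH} [∀ v, Group (H v)] {KH : ∀ v, Subgroup (H v)}
  (s : ∀ v, H v →* G v) (hs : ∀ᶠ v in cofinite, MapsTo (s v) (KH v) (Kc v))

/-- The restricted product `Πʳ s_v : Πʳ v, [H v, KH v] →* Πʳ v, [G v, Kc v]` of local homomorphisms
mapping `KH v` into `Kc v` for almost all `v` (Mathlib's `RestrictedProduct.mapAlongMonoidHom`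
along `id`). [folklore] -/
def piLocalHom : (Πʳ v, [H v, KH v]) →* Πʳ v, [G v, Kc v] :=
  RestrictedProduct.mapAlongMonoidHom H G id Filter.tendsto_id s hs

omit [NumberField K] [DecidableEq (HeightOneSpectrum (𝓞 K))] in
/-- Components of `piLocalHom`. [folklore] -/
@[simp] theorem piLocalHom_apply (h : Πʳ v, [H v, KH v]) (v : HeightOneSpectrum (𝓞 K)) :
    piLocalHom K s hs h v = s v (h v) := rfl

/-- **Pull-back of `⊗'_v r_v` along local homomorphisms** `s v : H v →* G v` (the shape in which a
SPLITTING of the metaplectic restricted product over a subgroup — e.g. a unitary dual pair, Kudla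
1994 Thm 3.1 / Harris–Kudla–Sweet 1996 §1 — is consumed: the local splittings are the caller's
data). [folklore] -/
def finiteAdelePullback : Representation ℂ (Πʳ v, [H v, KH v]) ↥(SchwartzBruhat (ι → FiniteAdeleRing (𝓞 K) K)) :=
  (finiteAdeleRep K ι r hK).comp (piLocalHom K s hs)

/-- `finiteAdelePullback` on pure tensors: `(h_v) ↦ ⊗_v r_v(s_v h_v) Φ_v`. [folklore] -/
theorem finiteAdelePullback_apply_piProdSB (h : Πʳ v, [H v, KH v]) (Φ : LocalSBFamily K ι) :
    finiteAdelePullback K ι r hK s hs h (piProdSB K ι Φ) =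
      piProdSB K ι (RestrictedFamily.smul r hK (piLocalHom K s hs h) Φ) :=
  finiteAdeleRep_apply_piProdSB K ι r hK _ Φ

omit [DecidableEq (HeightOneSpectrum (𝓞 K))] in
include hK hs in
/-- The base vectors are fixed by `KH v` under the pulled-back local representations, for almost
all `v`. [folklore] -/
theorem eventually_mem_fixedPoints_comp :
    ∀ᶠ v in cofinite, unitVec K ι v ∈
      Representation.fixedPoints (k := ℂ) (G := H v) ((r v).comp (s v)) (KH v) :=
  (hK.and hs).mono fun v hv =>
    (Representation.mem_fixedPoints _ (KH v) _).2 fun h hh => by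
      rw [MonoidHom.comp_apply]
      exact (Representation.mem_fixedPoints _ (Kc v) _).1 hv.1 (s v h) (hv.2 hh)

/-- `finiteAdelePullback` is `⊗'_v (r_v ∘ s_v)`: it is THE restricted tensor product representation of the
pulled-back local representations. [folklore] -/
theorem finiteAdelePullback_eq_finiteAdeleRep_comp :
    finiteAdelePullback K ι r hK s hs =
      finiteAdeleRep K ι (Kc := KH) (fun v => show Representation ℂ (H v) _ from (r v).comp (s v))
        (eventually_mem_fixedPoints_comp K ι r hK s hs) := by
  refine eq_finiteAdeleRep K ι _ _ fun h Φ => ?_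
  rw [finiteAdelePullback_apply_piProdSB]
  congr 1

variable [∀ v, TopologicalSpace (G v)] [∀ v, IsTopologicalGroup (G v)]
  [∀ v, TopologicalSpace (H v)]

/-- **Smoothness of the pull-back**: if moreover the global homomorphism `Πʳ s_v` is continuous
(e.g. all `s v` continuous and `KH v`, `Kc v` open — Mathlib's `RestrictedProduct.mapAlong_continuous`)
then the pulled-back representation is smooth and its orbit maps are locally constant. [folklore] -/
theorem isSmooth_finiteAdelePullback (hKo : ∀ v, IsOpen (Kc v : Set (G v))) (hr : ∀ v, (r v).IsSmooth)
    (hsc : Continuous (piLocalHom K s hs)) : (finiteAdelePullback K ι r hK s hs).IsSmooth :=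
  isSmooth_comp_of_continuous _ (isSmooth_finiteAdeleRep K ι r hK hKo hr) _ hsc

/-- Orbit maps of the pull-back are locally constant. [folklore] -/
theorem isLocallyConstant_finiteAdelePullback_apply (hKo : ∀ v, IsOpen (Kc v : Set (G v)))
    (hr : ∀ v, (r v).IsSmooth) (hsc : Continuous (piLocalHom K s hs))
    [SeparatelyContinuousMul (Πʳ v, [H v, KH v])]
    (Φ : ↥(SchwartzBruhat (ι → FiniteAdeleRing (𝓞 K) K))) :
    IsLocallyConstant fun h : Πʳ v, [H v, KH v] => finiteAdelePullback K ι r hK s hs h Φ :=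
  (isSmooth_finiteAdelePullback K ι r hK s hs hKo hr hsc).isLocallyConstant_apply _ Φ

end Pullback

end Literature.NumberTheory.Automorphic

end
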